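import Mathlib
import Literature.Analysis.FluidPDE.SelfSimilar
import Literature.Analysis.FluidPDE.AxisymmetricEuler
import Summits.NavierStokesRegularity.NavierStokesRegularity.Theorems.ScenarioCensusAncient
import Summits.NavierStokesRegularity.NavierStokesRegularity.Theorems.ScenarioCensusAncientSymmetry
import Summits.NavierStokesRegularity.NavierStokesRegularity.Theorems.ScenarioCensusAncientAnnex
import Summits.NavierStokesRegularity.NavierStokesRegularity.Theorems.ScenarioCensusForward
import Summits.NavierStokesRegularity.NavierStokesRegularity.Theorems.ScenarioCensusForwardSymmetry
import HarnessLib.Audit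
import HarnessLib

/-!
# Blow-up scenario census — five OPEN sub-rows booked v1.41 (lead g5 ORDER 12:15Z [2/3], after ref PRE-CHECK ✓
# 12:04Z [1/5]–[5/5]): F13e, A8rec, A8qp, A5fi, A5fe — VERBATIM from the ideator files, with PROVED sub-cell glue

CONED file (it imports `ScenarioCensusAncient.lean` for `Row_A5`, which sits in the TypeILiouville /
GaldiLiouvilleGate / EulerZoomLiouville cones); the cone-free rows stay in `…AncientAnnex` / `…ForwardSymmetry`.
Sources (bodies VERBATIM, binders spelled out: `E3 = EuclideanSpace ℝ (Fin 3)`, `e3 = EuclideanSpace.single 2 1`):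
* F13e — ns-idea-2 «order-meter» rev 4, `pub/ideators/ns-idea-2/lines/order-meter/line-order-meter.lean` :334
  (glue :367 / :372 / :376);
* A8rec / A8qp + vocabulary `pairVar` :181, `IsUniformlyRecurrent` :189, `IsQuiescentPast` :195 — ns-idea-3
  «backward-hull» rev 2, `pub/ideators/ns-idea-3/lines/backward-hull/line-backward-hull.rev2.lean` :203 / :214
  (glue :223 / :227);
* A5fi = `FellerSwirlLiouville` :223 / A5fe = `EventualFellerSwirlLiouville` :233 — ns-idea-4 «feller-swirl» v1,
  `pub/ideators/ns-idea-4/lines/feller-swirl/FellerSwirl_v1.lean` (glue ⇐ `Row_A5` one-liners, here).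
The lines' obligations / stubs / compositions are NOT typed (a LEAD registers skeletons).  Every row is an
`@[conjecture]` obligation node — nothing asserted.  No summit statement is proved here.
-/

noncomputable section

-- the summit and its single problem share the name `NavierStokesRegularity` (D-0017 nested layout)
set_option linter.dupNamespace false

open MeasureTheory Set Filter Topology Function
open scoped ENNReal NNReal

namespace Summit.NavierStokesRegularity.NavierStokesRegularity.Theorems.ScenarioCensus

open Literature.Analysis Literature.Analysis.FluidPDE

/-! ## Row F13e — the order meter, forward (ns-idea-2 order-meter rev 4 :334) -/

/-- **Row F13e** («order meter, forward», FORWARD / Clay class; = row F1 ∩ row F13m ∩ the two dimensionless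
windows, at orders `m ≥ 8 + 4A + 8√C₁`): a classical Leray–Hopf solution on `ℝ³ × [0,T)` from a rapidly
decaying `R_{2π/m}`-equivariant datum, with the Type-I rate at `T` (`IsTypeIBlowup u T`), the space window
`‖x‖ ‖u(t,x)‖ ≤ A ν` and the first-order window `(‖x‖ + √(ν(T−t)))² ‖∇u(t,x)‖ ≤ C₁ ν` on `[0,T)`, extends
smoothly past `T` whenever `8 + 4A + 8√C₁ ≤ m`.  VERBATIM `Row_F13e` (order-meter rev 4 :334); forward twin of
row A9e; junk guards `0 ≤ A`, `0 ≤ C₁` (threshold forces `m ≥ 8`).  OPEN — nothing asserted.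
[cite: KochNadirashviliSereginSverak2009, §1 conjecture (L) and §6 Prop. 6.1 (arXiv:0709.3599)] -/
@[conjecture] def Row_F13e : Prop :=
  ∀ (ν T A C₁ : ℝ) (m : ℕ), 0 < ν → 0 < T → 0 ≤ A → 0 ≤ C₁ → 8 + 4 * A + 8 * Real.sqrt C₁ ≤ (m : ℝ) →
    ∀ (u : ℝ → EuclideanSpace ℝ (Fin 3) → EuclideanSpace ℝ (Fin 3))
      (p : ℝ → EuclideanSpace ℝ (Fin 3) → ℝ),
    IsClassicalNSSolutionOn (Ico 0 T) ν 0 u p → IsLerayHopfOn T ν 0 (u 0) u →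
    HasRapidSpatialDecay (u 0) → IsTypeIBlowup u T →
    (∀ x : EuclideanSpace ℝ (Fin 3), u 0 (rotZ (2 * Real.pi / m) x) = rotZ (2 * Real.pi / m) (u 0 x)) →
    (∀ t ∈ Ico 0 T, ∀ x, ‖x‖ * ‖u t x‖ ≤ A * ν) →
    (∀ t ∈ Ico 0 T, ∀ x,
        (‖x‖ + Real.sqrt (ν * (T - t))) ^ (1 + 1) * ‖iteratedFDeriv ℝ 1 (u t) x‖ ≤ C₁ * ν) →
      HasSmoothExtensionPast ν 0 u T

/-- **F1 ⇒ F13e** (order-meter :367, ON PATH): rate carried, symmetry and windows unused. [folklore] -/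
theorem row_F13e_of_row_F1 (h : Row_F1) : Row_F13e :=
  fun ν T _ _ _ hν hT _ _ _ u p hcl hLH hdec hI _ _ _ => h ν T hν hT u p hcl hLH hdec hI

/-- **(∀ m, F13m m) ⇒ F13e** (order-meter :372): symmetry carried, rate and windows unused. [folklore] -/
theorem row_F13e_of_row_F13m (h : ∀ m : ℕ, Row_F13m m) : Row_F13e :=
  fun ν T _ _ m hν hT _ _ _ u p hcl hLH hdec _ hsym _ _ => h m ν T hν hT u p hcl hLH hdec hsym

/-- **F0 ⇒ F13e** (order-meter :376). [folklore] -/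
theorem row_F13e_of_row_F0 (h0 : Row_F0) : Row_F13e :=
  row_F13e_of_row_F1 (row_F1_of_F0 h0)

/-! ## Rows A8rec / A8qp — uniformly recurrent / quiescent past (ns-idea-3 backward-hull rev 2)

### Vocabulary (verbatim :181 / :189 / :195) -/

/-- **Pair variance** of two slices on `B(c,r)`: `∬ ‖(f x − f y) − (g x − g y)‖² dx dy` — a lower Lebesgue
integral (no junk), insensitive to null modifications and to adding (different) constants to `f` and `g`: the
constant-blind `L²(B × B)` discrepancy of the duality class (backward-hull rev 2 :181). [folklore] -/
def pairVar (c : EuclideanSpace ℝ (Fin 3)) (r : ℝ)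
    (f g : EuclideanSpace ℝ (Fin 3) → EuclideanSpace ℝ (Fin 3)) : ℝ≥0∞ :=
  ∫⁻ x in Metric.ball c r, ∫⁻ y in Metric.ball c r, ‖(f x - f y) - (g x - g y)‖ₑ ^ 2

/-- **Uniformly (Birkhoff-)recurrent past**: for every accuracy `ε > 0` and scale `R > 0` there is a gap bound
`ℓ > 0` such that every past interval `[a − ℓ, a]`, `a < 0`, contains an `ε`-almost-period `τ` of `u` in
`pairVar 0 R`, uniformly over `t ∈ (−R, 0)` (backward-hull rev 2 :189; periodic ⇒ uniformly recurrent).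
[folklore] -/
def IsUniformlyRecurrent (u : ℝ → EuclideanSpace ℝ (Fin 3) → EuclideanSpace ℝ (Fin 3)) : Prop :=
  ∀ ε : ℝ, 0 < ε → ∀ R : ℝ, 0 < R → ∃ ℓ : ℝ, 0 < ℓ ∧ ∀ a : ℝ, a < 0 →
    ∃ τ ∈ Icc (a - ℓ) a, ∀ t ∈ Ioo (-R) 0, pairVar 0 R (u (t + τ)) (u t) ≤ ENNReal.ofReal ε

/-- **Quiescent past**: `u(t) → β e₃` UNIFORMLY in space as `t → −∞`, for some axial constant `β e₃`, with NO
RATE (backward-hull rev 2 :195). [folklore] -/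
def IsQuiescentPast (u : ℝ → EuclideanSpace ℝ (Fin 3) → EuclideanSpace ℝ (Fin 3)) : Prop :=
  ∃ β : ℝ, ∀ ε : ℝ, 0 < ε → ∃ T : ℝ, 0 < T ∧ ∀ t : ℝ, t < -T →
    ∀ x : EuclideanSpace ℝ (Fin 3), ‖u t x - β • EuclideanSpace.single 2 (1 : ℝ)‖ ≤ ε

/-- **Row A8rec** (any bounded type · HELICAL, pitch `h ≠ 0` · bounded ancient mild (duality form `ν = 1`),
measurable slices · UNIFORMLY RECURRENT past): every slice is a.e. constant.  VERBATIM `Row_A8rec`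
(backward-hull rev 2 :203).  Sub-cell of row A8 (`row_A8rec_of_row_A8`).  OPEN — nothing asserted.
[cite: KochNadirashviliSereginSverak2009, §1 conjecture (L) and Thm 5.1 (arXiv:0709.3599)] -/
@[conjecture] def Row_A8rec : Prop :=
  ∀ h : ℝ, h ≠ 0 → ∀ u : ℝ → EuclideanSpace ℝ (Fin 3) → EuclideanSpace ℝ (Fin 3),
    FluidPDE.IsBoundedAncientMildSolution 1 u → (∀ t < 0, AEStronglyMeasurable (u t) volume) →
      (∀ t < 0, ∀ (θ : ℝ) (x : EuclideanSpace ℝ (Fin 3)),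
          u t (FluidPDE.rotZ θ x + (h * θ) • EuclideanSpace.single 2 (1 : ℝ)) = FluidPDE.rotZ θ (u t x)) →
        IsUniformlyRecurrent u →
          ∀ t < 0, ∃ b : EuclideanSpace ℝ (Fin 3), u t =ᵐ[volume] fun _ => b

/-- **Row A8qp** (any bounded type · HELICAL, pitch `h ≠ 0` · bounded ancient mild, measurable slices ·
QUIESCENT PAST, no rate): every slice is a.e. constant.  VERBATIM `Row_A8qp` (backward-hull rev 2 :214);
`⊇ A8t` (Type I in time).  Sub-cell of row A8 (`row_A8qp_of_row_A8`).  OPEN — nothing asserted.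
[cite: KochNadirashviliSereginSverak2009, §1 conjecture (L) and Thm 5.1 (arXiv:0709.3599)] -/
@[conjecture] def Row_A8qp : Prop :=
  ∀ h : ℝ, h ≠ 0 → ∀ u : ℝ → EuclideanSpace ℝ (Fin 3) → EuclideanSpace ℝ (Fin 3),
    FluidPDE.IsBoundedAncientMildSolution 1 u → (∀ t < 0, AEStronglyMeasurable (u t) volume) →
      (∀ t < 0, ∀ (θ : ℝ) (x : EuclideanSpace ℝ (Fin 3)),
          u t (FluidPDE.rotZ θ x + (h * θ) • EuclideanSpace.single 2 (1 : ℝ)) = FluidPDE.rotZ θ (u t x)) →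
        IsQuiescentPast u →
          ∀ t < 0, ∃ b : EuclideanSpace ℝ (Fin 3), u t =ᵐ[volume] fun _ => b

/-- **A8 ⇒ A8rec** (backward-hull :223): recurrence carried, not used. [folklore] -/
theorem row_A8rec_of_row_A8 (h8 : Row_A8) : Row_A8rec :=
  fun h hh u hu hmeas hscrew _ => h8 h hh u hu hmeas hscrew

/-- **A8 ⇒ A8qp** (backward-hull :227): quiescence carried, not used. [folklore] -/
theorem row_A8qp_of_row_A8 (h8 : Row_A8) : Row_A8qp :=
  fun h hh u hu hmeas hscrew _ => h8 h hh u hu hmeas hscrew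

/-! ## Rows A5fi / A5fe — Feller-swirl rungs of row A5 (ns-idea-4 feller-swirl v1 :223 / :233) -/

/-- **Row A5fi** (= `FellerSwirlLiouville`, the GLOBAL one-sided criterion): row A5 (bounded ancient mild,
duality form `ν = 1`, measurable slices, axisymmetric WITH swirl, `Γ` bounded) under the extra hypothesis that the
inflow number `−(x₀u₀ + x₁u₁) = −r u_r` is at most `2 − δ` EVERYWHERE: slices a.e. constant.  VERBATIM
(feller-swirl v1 :223).  Sub-cell of row A5 (`row_A5fi_of_row_A5`).  OPEN — nothing asserted.
[cite: KochNadirashviliSereginSverak2009, §5 (the bounded-swirl problem; arXiv:0709.3599)] -/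
@[conjecture] def Row_A5fi : Prop :=
  ∀ u : ℝ → EuclideanSpace ℝ (Fin 3) → EuclideanSpace ℝ (Fin 3), IsBoundedAncientMildSolution 1 u →
    (∀ t < 0, AEStronglyMeasurable (u t) volume) →
      (∀ t < 0, IsAxisymmetric (u t)) →
        (∃ C : ℝ, ∀ t < 0, ∀ x, |swirl (u t) x| ≤ C) →
          (∃ δ : ℝ, 0 < δ ∧ ∀ t < 0, ∀ x, -(2 - δ) ≤ x 0 * u t x 0 + x 1 * u t x 1) →
            ∀ t < 0, ∃ b : EuclideanSpace ℝ (Fin 3), u t =ᵐ[volume] fun _ => b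

/-- **Row A5fe** (= `EventualFellerSwirlLiouville`, K2): row A5 under an EVENTUAL (far-field, a.e.) bound
`−r u_r ≤ 2 − δ` for `cylRadius x ≥ R₀`: slices a.e. constant.  VERBATIM (feller-swirl v1 :233).  Sub-cell of row
A5 (`row_A5fe_of_row_A5`); contains A5fi (`row_A5fi_of_row_A5fe`).  OPEN — nothing asserted.
[cite: KochNadirashviliSereginSverak2009, §5 (the bounded-swirl problem; arXiv:0709.3599)] -/
@[conjecture] def Row_A5fe : Prop :=
  ∀ u : ℝ → EuclideanSpace ℝ (Fin 3) → EuclideanSpace ℝ (Fin 3), IsBoundedAncientMildSolution 1 u →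
    (∀ t < 0, AEStronglyMeasurable (u t) volume) →
      (∀ t < 0, IsAxisymmetric (u t)) →
        (∃ C : ℝ, ∀ t < 0, ∀ x, |swirl (u t) x| ≤ C) →
          (∃ δ : ℝ, 0 < δ ∧ ∃ R₀ : ℝ, ∀ t < 0, ∀ᵐ x ∂volume,
              R₀ ≤ cylRadius x → -(2 - δ) ≤ x 0 * u t x 0 + x 1 * u t x 1) →
            ∀ t < 0, ∃ b : EuclideanSpace ℝ (Fin 3), u t =ᵐ[volume] fun _ => b

/-- **A5 ⇒ A5fi**: the inflow hypothesis is carried, not used (`Row_A5` = the leaf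
`AxisymmetricLiouvilleBoundedSwirl`). [folklore] -/
theorem row_A5fi_of_row_A5 (h5 : Row_A5) : Row_A5fi :=
  fun u hu hmeas haxi hsw _ => h5 u hu hmeas haxi hsw

/-- **A5 ⇒ A5fe**: the eventual inflow hypothesis is carried, not used. [folklore] -/
theorem row_A5fe_of_row_A5 (h5 : Row_A5) : Row_A5fe :=
  fun u hu hmeas haxi hsw _ => h5 u hu hmeas haxi hsw

/-- **A5fe ⇒ A5fi**: an everywhere bound is an eventual a.e. bound (`R₀ := 0`). [folklore] -/
theorem row_A5fi_of_row_A5fe (h : Row_A5fe) : Row_A5fi := by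
  intro u hu hmeas haxi hsw hin
  obtain ⟨δ, hδ, hδin⟩ := hin
  exact h u hu hmeas haxi hsw ⟨δ, hδ, 0, fun t ht => Eventually.of_forall fun x _ => hδin t ht x⟩

end Summit.NavierStokesRegularity.NavierStokesRegularity.Theorems.ScenarioCensus

end
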